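import Literature.NumberTheory.EllipticCurves.BSDAnalyticRankTunnellLeavesProofs
import HarnessLib

/-!
# The "Waldspurger shape" of Tunnell p. 329 is equivalent to Theorem 3 (given Theorem 2)

Sibling proof file of `TunnellHalfIntegralForms` (the named facts
`Literature.NumberTheory.EllipticCurves.Tunnell1983.Tunnell1983_waldspurger_triv` /
`Literature.NumberTheory.EllipticCurves.Tunnell1983.Tunnell1983_waldspurger_chi2`: Waldspurger's
theorem [Waldspurger 1981, Thm 1] for the newform `φ` of level `32`, weight `3/2`, level `128`,
character `1` / `χ₂`, *as applied by Tunnell on p. 329*). That file PROVES the direction Tunnell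
uses: `Tunnell1983_waldspurger_chi2 → Tunnell1983_b_sq_eq_const_mul_L_one → Tunnell1983_L_one_even`
(the last step with the two `L`-values `L(E², 1)`, `L(E¹⁰, 1)` of Birch–Swinnerton-Dyer 1965 and the
continuation of `L(E_n, s)`). This file PROVES the converse direction, so that the exact logical
strength of the vendored Waldspurger statement is on record:

* `waldspurgerShape_of_coeff_sq` — **abstract converse of `Tunnell1983.comparison`**: if two cusp
  forms `P, Q ∈ S_{3/2}(128, χ)` have `q`-expansion coefficients `coef n` (odd `n`), resp.
  `[n ≡ 1 (8)] coef n`, if `coef` vanishes on the odd classes other than `1` and `2 i₁ + 1`, and if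
  `Lval n = κ² coef(n)² / √n` for odd square-free `n` with one constant `κ ≠ 0`, then
  `WaldspurgerShape χ guard Lval P Q` holds — witnessed by `A(n) = κ coef(n) n^{-1/4}` and the four
  forms `κ Q` (class `1`), `κ (P - Q)` (class `2 i₁ + 1`), `0`, `0`.
* `Tunnell1983_waldspurger_chi2_of_mem_of_L_one_even` — **Theorem 3 (even twists,
  `Tunnell1983_L_one_even`: `L(E^{2d}, 1) = b(d)² β / (2 √(2d))`) together with the membership
  `g θ₄, g θ₁₆ ∈ S_{3/2}(128, χ₂)` (part of Theorem 2, p. 327) implies `Tunnell1983_waldspurger_chi2`**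
  (`κ² = β / (2√2)`); `Tunnell1983_waldspurger_chi2_of_thm2_of_L_one_even` takes the membership from
  `Tunnell1983_thm2_chi2`; `Tunnell1983_waldspurger_chi2_iff_L_one_even` is the resulting
  equivalence (under the membership and `BirchSwinnertonDyer1965_L_one_two_ten`).
* `Tunnell1983_waldspurger_triv_of_mem_of_L_one_odd`, `…_of_thm2_of_L_one_odd`,
  `Tunnell1983_waldspurger_triv_iff_L_one_odd` — the same for the trivial character
  (`g θ₂, g θ₈`, `a(n)`, `κ² = β / 4`, `BirchSwinnertonDyer1965_L_one_one_three`).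

Consequently the named facts `Tunnell1983_waldspurger_chi2`, `Tunnell1983_b_sq_eq_const_mul_L_one`
and `Tunnell1983_L_one_even` (resp. `_triv`, `_a_sq_…`, `_L_one_odd`) are pairwise equivalent modulo
Theorem 2's membership statement, the two Birch–Swinnerton-Dyer `L`-values and
`hasEntireLFunction_congruentNumberCurve_holds`; none of them is thereby brought closer to a proof —
their common root, Waldspurger's theorem (J. Math. Pures Appl. 60 (1981), Thm 1; made explicit in
Purkait, LMS J. Comput. Math. 16 (2013), Thm 7), is not formalised. No statement is introduced here.

## References

* J. B. Tunnell, *A classical Diophantine problem and modular forms of weight 3/2*, Invent. Math.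
  72 (1983) 323–334: bases of `S_{3/2}(128, ·)` and Thm 2 (p. 327), Theorem (Waldspurger) (p. 328),
  proof of Thm 3 (p. 329). Read on the GDZ scan of Inventiones 72 (`PPN356556735_0072`, `LOG_0021`).
* J.-L. Waldspurger, *Sur les coefficients de Fourier des formes modulaires de poids demi-entier*,
  J. Math. Pures Appl. 60 (1981) 375–484, Thm 1.
* S. Purkait, *Explicit application of Waldspurger's theorem*, LMS J. Comput. Math. 16 (2013)
  216–245 (arXiv:1208.4329), Thm 7 and §5 (the sets `U_p(e, φ)`; for `φ` of level `32`: Case 3(a) at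
  `p = 2`, Case 2(a) at odd `p`).
-/

noncomputable section

open scoped MatrixGroups Manifold

open UpperHalfPlane Complex Literature.NumberTheory.EllipticCurves.ModularForms

namespace Literature.NumberTheory.EllipticCurves

namespace Tunnell1983

/-! ### The abstract converse of the comparison argument -/

section Converse

variable {χ : DirichletCharacter ℂ 128}

/-- **Converse of the p. 329 comparison.** Let `P, Q ∈ S_{3/2}(128, χ)` have `q`-expansion
coefficients `coef n` for odd `n`, resp. `coef n` on the class `n ≡ 1 (8)` and `0` elsewhere, where
`coef` vanishes on the odd classes modulo `8` other than `1` and `2 i₁ + 1`, and suppose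
`Lval n = κ² coef(n)² / √n` for odd square-free `n` (under `guard n`) with a constant `κ ≠ 0`. Then
`WaldspurgerShape χ guard Lval P Q`: take `A(n) = κ coef(n) n^{-1/4}` and the forms `κ Q` (class `1`),
`κ P - κ Q` (class `2 i₁ + 1`) and `0` (the two remaining classes); their span is `span {P, Q}`.
[folklore] -/
theorem waldspurgerShape_of_coeff_sq {guard : ℕ → Prop} {Lval : ℕ → ℂ} {P Q : ℍ → ℂ}
    {coef : ℕ → ℂ} {κ : ℂ} {i₁ : Fin 4} (hi₁ : i₁ ≠ 0) (hκ : κ ≠ 0)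
    (hP : P ∈ halfIntCuspForms 3 128 χ) (hQ : Q ∈ halfIntCuspForms 3 128 χ)
    (hPq : ∀ n : ℕ, Odd n → qCoeffs P n = coef n)
    (hQq : ∀ n : ℕ, qCoeffs Q n = if n % 8 = 1 then coef n else 0)
    (hcoef : ∀ n : ℕ, Odd n → n % 8 ≠ 1 → n % 8 ≠ 2 * (i₁ : ℕ) + 1 → coef n = 0)
    (hL : ∀ n : ℕ, Squarefree n → Odd n → guard n →
      Lval n = κ ^ 2 * coef n ^ 2 / (Real.sqrt n : ℂ)) :
    WaldspurgerShape χ guard Lval P Q := by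
  have hPM : P ∈ halfIntModularForms 3 128 χ := halfIntCuspForms_le_halfIntModularForms 3 128 χ hP
  have hQM : Q ∈ halfIntModularForms 3 128 χ := halfIntCuspForms_le_halfIntModularForms 3 128 χ hQ
  have hi₁' : (i₁ : ℕ) ≠ 0 := fun h ↦ hi₁ (Fin.ext h)
  -- Waldspurger's function `A(n) = κ coef(n) n^{-1/4}`
  obtain ⟨A, hA⟩ : ∃ A : ℕ → ℂ, ∀ n, A n = κ * coef n / (((n : ℝ) ^ (4⁻¹ : ℝ) : ℝ) : ℂ) :=
    ⟨fun n ↦ κ * coef n / (((n : ℝ) ^ (4⁻¹ : ℝ) : ℝ) : ℂ), fun _ ↦ rfl⟩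
  have hAr : ∀ {n : ℕ}, n ≠ 0 → A n * (((n : ℝ) ^ (4⁻¹ : ℝ) : ℝ) : ℂ) = κ * coef n :=
    fun {n} hn ↦ by rw [hA n, div_mul_cancel₀ (κ * coef n) (fourthRoot_ne_zero hn)]
  -- the four forms: `κ Q` on the class `1`, `κ P - κ Q` on the class `2 i₁ + 1`, `0` elsewhere
  obtain ⟨F, hF0, hF1, hF2⟩ : ∃ F : Fin 4 → ℍ → ℂ, F 0 = κ • Q ∧ F i₁ = κ • P + (-κ) • Q ∧
      ∀ i, i ≠ 0 → i ≠ i₁ → F i = 0 :=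
    ⟨fun i ↦ if i = 0 then κ • Q else if i = i₁ then κ • P + (-κ) • Q else 0, by simp,
      by simp [hi₁], fun i h0 h1 ↦ by simp [h0, h1]⟩
  have odd_of_mod : ∀ {n : ℕ} {i : Fin 4}, n % 8 = 2 * (i : ℕ) + 1 → Odd n := by
    intro n i h
    rw [Nat.odd_iff]
    omega
  -- coefficients of the two nonzero forms
  have hq0 : ∀ n, qCoeffs (F 0) n = κ * (if n % 8 = 1 then coef n else 0) := fun n ↦ by
    rw [hF0, qCoeffs_smul hQM, Pi.smul_apply, smul_eq_mul, hQq n]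
  have hq1 : ∀ n, Odd n →
      qCoeffs (F i₁) n = κ * coef n + (-κ) * (if n % 8 = 1 then coef n else 0) := fun n hn ↦ by
    rw [hF1, qCoeffs_pair hPM hQM, hPq n hn, hQq n]
  refine ⟨A, fun t ht hodd hg ↦ ?_, F, fun i ↦ ?_, fun i n hodd hn ↦ ?_, fun i n hsq hn ↦ ?_, ?_⟩
  · -- (i) `A(t)² = Lval t`
    rw [hL t ht hodd hg, hA t, div_pow, mul_pow, fourthRoot_sq]
  · -- the `F i` are cusp forms
    by_cases hi0 : i = 0
    · subst hi0
      rw [hF0]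
      exact Submodule.smul_mem _ _ hQ
    by_cases hii : i = i₁
    · subst hii
      rw [hF1]
      exact Submodule.add_mem _ (Submodule.smul_mem _ _ hP) (Submodule.smul_mem _ _ hQ)
    · rw [hF2 i hi0 hii]
      exact Submodule.zero_mem _
  · -- support on the class `2 i + 1` (odd `n`)
    by_cases hi0 : i = 0
    · subst hi0
      have hn1 : n % 8 ≠ 1 := by simpa using hn
      rw [hq0 n, if_neg hn1, mul_zero]
    by_cases hii : i = i₁
    · subst hii
      rw [hq1 n hodd]
      by_cases hn1 : n % 8 = 1
      · rw [if_pos hn1]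
        ring
      · rw [if_neg hn1, hcoef n hodd hn1 hn]
        ring
    · rw [hF2 i hi0 hii, qCoeffs_zero, Pi.zero_apply]
  · -- the coefficient `A(n) n^{1/4}` at square-free `n ≡ 2 i + 1 (8)`
    have hn0 : n ≠ 0 := fun h ↦ by simp [h] at hsq
    rw [hAr hn0]
    by_cases hi0 : i = 0
    · subst hi0
      have hn1 : n % 8 = 1 := by simpa using hn
      rw [hq0 n, if_pos hn1]
    by_cases hii : i = i₁
    · subst hii
      have hn1 : n % 8 ≠ 1 := by omega
      rw [hq1 n (odd_of_mod hn), if_neg hn1]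
      ring
    · have hii' : (i : ℕ) ≠ (i₁ : ℕ) := fun h ↦ hii (Fin.ext h)
      have hi0' : (i : ℕ) ≠ 0 := fun h ↦ hi0 (Fin.ext h)
      rw [hF2 i hi0 hii, qCoeffs_zero, Pi.zero_apply,
        hcoef n (odd_of_mod hn) (by omega) (by omega), mul_zero]
  · -- the span
    apply le_antisymm
    · rw [Submodule.span_le]
      rintro _ ⟨i, rfl⟩
      by_cases hi0 : i = 0
      · subst hi0
        rw [hF0]
        exact Submodule.smul_mem _ _ (Submodule.subset_span (by simp))
      by_cases hii : i = i₁
      · subst hii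
        rw [hF1]
        exact Submodule.add_mem _ (Submodule.smul_mem _ _ (Submodule.subset_span (by simp)))
          (Submodule.smul_mem _ _ (Submodule.subset_span (by simp)))
      · rw [hF2 i hi0 hii]
        exact Submodule.zero_mem _
    · rw [Submodule.span_le]
      have hQ' : Q ∈ Submodule.span ℂ (Set.range F) := by
        have h := Submodule.smul_mem _ κ⁻¹
          (Submodule.subset_span ⟨0, rfl⟩ : F 0 ∈ Submodule.span ℂ (Set.range F))
        rwa [hF0, smul_smul, inv_mul_cancel₀ hκ, one_smul] at h
      have hP' : P ∈ Submodule.span ℂ (Set.range F) := by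
        have h := Submodule.smul_mem _ κ⁻¹
          (Submodule.subset_span ⟨i₁, rfl⟩ : F i₁ ∈ Submodule.span ℂ (Set.range F))
        rw [hF1, smul_add, smul_smul, smul_smul, inv_mul_cancel₀ hκ, one_smul, mul_neg,
          inv_mul_cancel₀ hκ, neg_one_smul] at h
        have h2 := Submodule.add_mem _ h hQ'
        rwa [neg_add_cancel_right] at h2
      rintro f (rfl | rfl)
      · exact hP'
      · exact hQ'

end Converse

/-! ### Character `χ₂`: `Tunnell1983_waldspurger_chi2` from Theorem 3 (even) and Theorem 2 -/

/-- **Theorem 3 (even twists) and the membership `g θ₄, g θ₁₆ ∈ S_{3/2}(128, χ₂)` imply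
Waldspurger's theorem as applied on p. 329 (character `χ₂`).** With `κ² = β/(2√2)`:
`L(E^{2d}, 1) = b(d)² β/(2√(2d)) = κ² b(d)²/√d`, the coefficients of `g θ₄`, `g θ₁₆` are `b(n)`
(odd `n`), `[n ≡ 1 (8)] b(n)` (`qCoeffs_tunnellForm_four/sixteen`), and `b` vanishes on the classes
`3, 7` (`b_eq_zero_of_mod_eight`); apply `waldspurgerShape_of_coeff_sq` with `i₁ = 2` (class `5`).
[cite: Tunnell1983Congruent, Thm 3 and its proof, pp. 328–329] -/
theorem Tunnell1983_waldspurger_chi2_of_mem_of_L_one_even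
    (h4 : tunnellForm 4 ∈ halfIntCuspForms 3 128 tunnellChar)
    (h16 : tunnellForm 16 ∈ halfIntCuspForms 3 128 tunnellChar)
    (hT : Tunnell1983_L_one_even) : Tunnell1983_waldspurger_chi2 := by
  have hc : 0 < tunnellPeriod / (2 * Real.sqrt 2) := by
    have := tunnellPeriod_pos
    positivity
  set κ : ℂ := (Real.sqrt (tunnellPeriod / (2 * Real.sqrt 2)) : ℂ) with hκ
  have hκ0 : κ ≠ 0 := Complex.ofReal_ne_zero.mpr (Real.sqrt_pos.mpr hc).ne'
  have hκsq : κ ^ 2 = ((tunnellPeriod / (2 * Real.sqrt 2) : ℝ) : ℂ) := by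
    rw [hκ, ← Complex.ofReal_pow, Real.sq_sqrt hc.le]
  refine waldspurgerShape_of_coeff_sq (i₁ := 2) (by decide) hκ0 h4 h16
    (coef := fun n ↦ ((b n : ℚ) : ℂ))
    (fun n hn ↦ by rw [qCoeffs_tunnellForm_four n, if_pos hn]) qCoeffs_tunnellForm_sixteen
    (fun n hn h1 h5 ↦ ?_) (fun n hn hodd hg ↦ ?_)
  · have h5' : n % 8 ≠ 5 := by simpa using h5
    have h8 : n % 8 = 3 ∨ n % 8 = 7 := by
      have := Nat.odd_iff.mp hn
      omega
    simp [b_eq_zero_of_mod_eight h8]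
  · have hn0 : (0 : ℝ) < n := by exact_mod_cast Nat.pos_of_ne_zero hn.ne_zero
    have hs2 : (Real.sqrt 2 : ℂ) ≠ 0 := Complex.ofReal_ne_zero.mpr (by positivity)
    have hsn : (Real.sqrt n : ℂ) ≠ 0 := Complex.ofReal_ne_zero.mpr (Real.sqrt_pos.mpr hn0).ne'
    show (congruentNumberCurve (2 * n)).entireLFunction 1 =
      κ ^ 2 * ((b n : ℚ) : ℂ) ^ 2 / (Real.sqrt n : ℂ)
    rw [hT hn hodd hg, hκsq, Real.sqrt_mul (by norm_num : (0 : ℝ) ≤ 2)]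
    push_cast
    field_simp

/-- **`Tunnell1983_waldspurger_chi2` from Theorem 2 (`Tunnell1983_thm2_chi2`, which contains the
membership `g θ₄, g θ₁₆ ∈ S_{3/2}(128, χ₂, φ) ≤ S_{3/2}(128, χ₂)`) and Theorem 3, even twists
(`Tunnell1983_L_one_even`).** [cite: Tunnell1983Congruent, Thm 2 (p. 327), Thm 3 (pp. 328–329)] -/
theorem Tunnell1983_waldspurger_chi2_of_thm2_of_L_one_even (h2 : Tunnell1983_thm2_chi2)
    (hT : Tunnell1983_L_one_even) : Tunnell1983_waldspurger_chi2 :=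
  Tunnell1983_waldspurger_chi2_of_mem_of_L_one_even
    (shimuraSubspace_le_halfIntCuspForms 3 128 _ _ h2.1)
    (shimuraSubspace_le_halfIntCuspForms 3 128 _ _ h2.2) hT

/-- **Waldspurger's theorem as applied on p. 329 (character `χ₂`) is EQUIVALENT to Theorem 3 (even
twists)**, given the membership `g θ₄, g θ₁₆ ∈ S_{3/2}(128, χ₂)` and the two `L`-values
`L(E², 1) = β/(2√2)`, `L(E¹⁰, 1) = 2β/√10` (`BirchSwinnertonDyer1965_L_one_two_ten`); the
continuation of `L(E_n, s)` is the theorem `hasEntireLFunction_congruentNumberCurve_holds`. Forward: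
`Tunnell1983_L_one_even_of_leaves` (Tunnell's argument, p. 329); backward:
`Tunnell1983_waldspurger_chi2_of_mem_of_L_one_even`.
[cite: Tunnell1983Congruent, Theorem (Waldspurger) p. 328 and proof of Thm 3, p. 329] -/
theorem Tunnell1983_waldspurger_chi2_iff_L_one_even
    (h4 : tunnellForm 4 ∈ halfIntCuspForms 3 128 tunnellChar)
    (h16 : tunnellForm 16 ∈ halfIntCuspForms 3 128 tunnellChar)
    (hV : BirchSwinnertonDyer1965_L_one_two_ten) :
    Tunnell1983_waldspurger_chi2 ↔ Tunnell1983_L_one_even :=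
  ⟨fun hW ↦ Tunnell1983_L_one_even_of_leaves hW hV hasEntireLFunction_congruentNumberCurve_holds,
    Tunnell1983_waldspurger_chi2_of_mem_of_L_one_even h4 h16⟩

/-! ### Trivial character: `Tunnell1983_waldspurger_triv` from Theorem 3 (odd) and Theorem 2 -/

/-- **Theorem 3 (odd twists, `Tunnell1983_L_one_odd`: `L(E^d, 1) = a(d)² β/(4√d)`) and the
membership `g θ₂, g θ₈ ∈ S_{3/2}(128)` imply Waldspurger's theorem as applied on p. 329 (trivial
character)**, with `κ² = β/4`, `i₁ = 1` (class `3`), `a` vanishing on the classes `5, 7`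
(`a_eq_zero_of_mod_eight`). [cite: Tunnell1983Congruent, Thm 3 and its proof, pp. 328–329] -/
theorem Tunnell1983_waldspurger_triv_of_mem_of_L_one_odd
    (h2 : tunnellForm 2 ∈ halfIntCuspForms 3 128 1)
    (h8 : tunnellForm 8 ∈ halfIntCuspForms 3 128 1)
    (hT : Tunnell1983_L_one_odd) : Tunnell1983_waldspurger_triv := by
  have hc : 0 < tunnellPeriod / 4 := by
    have := tunnellPeriod_pos
    positivity
  set κ : ℂ := (Real.sqrt (tunnellPeriod / 4) : ℂ) with hκ
  have hκ0 : κ ≠ 0 := Complex.ofReal_ne_zero.mpr (Real.sqrt_pos.mpr hc).ne'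
  have hκsq : κ ^ 2 = ((tunnellPeriod / 4 : ℝ) : ℂ) := by
    rw [hκ, ← Complex.ofReal_pow, Real.sq_sqrt hc.le]
  refine waldspurgerShape_of_coeff_sq (i₁ := 1) (by decide) hκ0 h2 h8
    (coef := fun n ↦ ((a n : ℚ) : ℂ))
    (fun n hn ↦ by rw [qCoeffs_tunnellForm_two n, if_pos hn]) qCoeffs_tunnellForm_eight
    (fun n hn h1 h3 ↦ ?_) (fun n hn hodd hg ↦ ?_)
  · have h3' : n % 8 ≠ 3 := by simpa using h3
    have h57 : n % 8 = 5 ∨ n % 8 = 7 := by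
      have := Nat.odd_iff.mp hn
      omega
    simp [a_eq_zero_of_mod_eight h57]
  · have hn0 : (0 : ℝ) < n := by exact_mod_cast Nat.pos_of_ne_zero hn.ne_zero
    have hsn : (Real.sqrt n : ℂ) ≠ 0 := Complex.ofReal_ne_zero.mpr (Real.sqrt_pos.mpr hn0).ne'
    show (congruentNumberCurve n).entireLFunction 1 =
      κ ^ 2 * ((a n : ℚ) : ℂ) ^ 2 / (Real.sqrt n : ℂ)
    rw [hT hn hodd hg, hκsq]
    push_cast
    field_simp

/-- **`Tunnell1983_waldspurger_triv` from Theorem 2 (`Tunnell1983_thm2_triv`) and Theorem 3, odd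
twists (`Tunnell1983_L_one_odd`).** [cite: Tunnell1983Congruent, Thm 2 (p. 327), Thm 3 (pp. 328–329)] -/
theorem Tunnell1983_waldspurger_triv_of_thm2_of_L_one_odd (h2 : Tunnell1983_thm2_triv)
    (hT : Tunnell1983_L_one_odd) : Tunnell1983_waldspurger_triv :=
  Tunnell1983_waldspurger_triv_of_mem_of_L_one_odd
    (shimuraSubspace_le_halfIntCuspForms 3 128 _ _ h2.1)
    (shimuraSubspace_le_halfIntCuspForms 3 128 _ _ h2.2) hT

/-- **Waldspurger's theorem as applied on p. 329 (trivial character) is EQUIVALENT to Theorem 3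
(odd twists)**, given the membership `g θ₂, g θ₈ ∈ S_{3/2}(128)` and the two `L`-values
`L(E, 1) = β/4`, `L(E³, 1) = β/√3` (`BirchSwinnertonDyer1965_L_one_one_three`).
[cite: Tunnell1983Congruent, Theorem (Waldspurger) p. 328 and proof of Thm 3, p. 329] -/
theorem Tunnell1983_waldspurger_triv_iff_L_one_odd
    (h2 : tunnellForm 2 ∈ halfIntCuspForms 3 128 1)
    (h8 : tunnellForm 8 ∈ halfIntCuspForms 3 128 1)
    (hV : BirchSwinnertonDyer1965_L_one_one_three) :
    Tunnell1983_waldspurger_triv ↔ Tunnell1983_L_one_odd :=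
  ⟨fun hW ↦ Tunnell1983_L_one_odd_of_leaves hW hV hasEntireLFunction_congruentNumberCurve_holds,
    Tunnell1983_waldspurger_triv_of_mem_of_L_one_odd h2 h8⟩

end Tunnell1983

end Literature.NumberTheory.EllipticCurves
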